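import Mathlib
import HarnessLib.Audit
import Summits.PneNP.PneNP.Theorems.PstarGateUnit
import Summits.PneNP.PneNP.Theorems.PstarSharingBound
import Summits.PneNP.PneNP.Theorems.PstarChordBridgeTools

/-!
# Readers of a maximally shared core: private-touching readers are fresh gates (ROUND-24, memo §13.2; target `TerminalFiveMaxSharing`)

FRONTIER range-avoidance ladder, rung F-N3, ROUND 24 (cell `pnp-ideate`, planner memo `r24/CORE-BOUND-NOTES.md` §12.1 (sharing bound R0),
§13.2 (the maximal-sharing regime `2·#sharedSlots = #J₀`); typed target `PstarCoreBoundTargets.TerminalFiveMaxSharing` (p646951);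
restricted-model proof complexity — nothing here bears on `P` versus `NP`).

COUNTING ONLY.  At maximal sharing an XOR-closed family `J₀` is TIGHT for `(r,3/2)`-expansion: `2·#bdry J₀ ≤ 3·#J₀`
(`two_mul_card_bdry_le_of_maxSharing`, from `PstarSharingBound.card_bdry_add_card_sharedSlots_le`).  A monomial reader `g ∉ J₀` inside the
radius (`#(J₀ + g) ≤ r`) that touches a boundary AND variable of a tight family must bring its OTHER AND variable from outside the family
(`partner_fresh_of_tight`, by pnp-ideate-prover-2's `PstarGateUnit.false_of_tight_payer`: a payer kills a tight family).  Consequences for the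
readers `G₁ ∪ G₂` of a terminal core at maximal sharing whose co-edges `N` are chords (`readers_of_maxSharing`):
* no CROSS reader (both AND variables private) — the hypothesis `hcross` of `PstarChordBridge.BridgeData.WF` holds;
* every reader touching a private `p` of a chord is a GATE `(p, z)` with `z` not a variable of ANY output of `J₀` — the shape treated by
  `PstarFreshGate` (there with `z` moreover isolated: `z ∉ C₁ ∪ C₂` and in no other reader, which maximal sharing does NOT force — a literal
  reader `(σ, z)` on a shared variable `σ` of `J₀` may reuse `z`).
-/

set_option linter.dupNamespace false -- `Summit.PneNP.PneNP.…`: summit = sub-problem name (D-0017 single-conjunct layout)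

open Finset Literature.Computability.Complexity
open Summit.PneNP.PneNP.Theorems.PstarTyped (Typed)
open Summit.PneNP.PneNP.Theorems.PstarSALevel (varSet bdry BoundaryExpanding SimpleOverlap)
open Summit.PneNP.PneNP.Theorems.PstarGapLinearised (andPair)
open Summit.PneNP.PneNP.Theorems.PstarChordEndgameTools (mem_andPair_iff)
open Summit.PneNP.PneNP.Theorems.PstarCoreBound (XorClosed)
open Summit.PneNP.PneNP.Theorems.PstarChordRepair (IsChord)
open Summit.PneNP.PneNP.Theorems.PstarSharingBound (sharedSlots card_bdry_add_card_sharedSlots_le)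
open Summit.PneNP.PneNP.Theorems.PstarChordBridgeTools (privs mem_privs)
open Summit.PneNP.PneNP.Theorems.PstarGateUnit (false_of_tight_payer)

namespace Summit.PneNP.PneNP.Theorems.PstarMaxSharingReaders

variable {n m : ℕ}

/-- **At maximal sharing an XOR-closed family is tight**: `2·#sharedSlots = #J₀ ⇒ 2·#bdry J₀ ≤ 3·#J₀`. -/
theorem two_mul_card_bdry_le_of_maxSharing (I : LocalMap 4 n m) {J₀ : Finset (Fin m)} (hX : XorClosed I J₀)
    (hmax : 2 * (sharedSlots I J₀).card = J₀.card) : 2 * (bdry I J₀).card ≤ 3 * J₀.card := by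
  have h := card_bdry_add_card_sharedSlots_le I J₀ hX
  omega

/-- A boundary variable of `X` is held by some member of `X`. -/
theorem exists_mem_of_mem_bdry (I : LocalMap 4 n m) {X : Finset (Fin m)} {v : Fin n} (hv : v ∈ bdry I X) : ∃ j ∈ X, v ∈ varSet I j := by
  classical
  unfold PstarSALevel.bdry at hv
  rw [mem_filter, card_eq_one] at hv
  obtain ⟨j, hj⟩ := hv.2
  have : j ∈ X.filter fun j => v ∈ varSet I j := by rw [hj]; exact mem_singleton_self j
  exact ⟨j, (mem_filter.1 this).1, (mem_filter.1 this).2⟩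

/-- The two AND slots `2, 3`: the "other" one. -/
theorem and_slots {s s' : Fin 4} (hs : 2 ≤ s.val) (hs' : 2 ≤ s'.val) (hne : s ≠ s') :
    (s = 2 ∧ s' = 3) ∨ (s = 3 ∧ s' = 2) := by
  rcases s with ⟨s, h4⟩
  rcases s' with ⟨s', h4'⟩
  simp only [Fin.ext_iff, ne_eq] at *
  omega

/-- **A reader touching a boundary AND variable of a tight family brings its partner from outside** (`false_of_tight_payer`).  `X` tight
(`2·#bdry X ≤ 3·#X`), `g ∉ X` with `#(X + g) ≤ r`, the AND variable in slot `s` of `g` on the boundary of `X`: then the AND variable in the other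
AND slot `s'` of `g` is a variable of NO member of `X`. -/
theorem partner_fresh_of_tight (I : LocalMap 4 n m) {r : ℕ} (hB : BoundaryExpanding r I) {X : Finset (Fin m)} {g : Fin m} (hg : g ∉ X)
    (hr : (insert g X).card ≤ r) (htight : 2 * (bdry I X).card ≤ 3 * X.card) {s s' : Fin 4} (hs : 2 ≤ s.val) (hs' : 2 ≤ s'.val)
    (hne : s ≠ s') (hb : I.vars g s ∈ bdry I X) : ∀ j ∈ X, I.vars g s' ∉ varSet I j := by
  intro j hj hv
  have hs₀ : I.vars g s ∈ andPair I g := by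
    rw [mem_andPair_iff]
    rcases and_slots hs hs' hne with ⟨h, -⟩ | ⟨h, -⟩ <;> subst h
    · exact Or.inl rfl
    · exact Or.inr rfl
  refine false_of_tight_payer I hB hg hr htight (fun v hv' => ?_) hs₀ hb
  rw [mem_andPair_iff] at hv'
  -- `v` is the slot-`s` or the slot-`s'` variable of `g`
  have hv'' : v = I.vars g s ∨ v = I.vars g s' := by
    rcases and_slots hs hs' hne with ⟨h, h'⟩ | ⟨h, h'⟩ <;> subst h <;> subst h'
    · exact hv'
    · exact hv'.symm
  rcases hv'' with rfl | rfl
  · exact exists_mem_of_mem_bdry I hb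
  · exact ⟨j, hj, hv⟩

/-- **No CROSS reader on a tight family**: a reader `g ∉ X` inside the radius cannot have both AND variables on the boundary of `X`. -/
theorem not_cross_of_tight (I : LocalMap 4 n m) {r : ℕ} (hB : BoundaryExpanding r I) {X : Finset (Fin m)}
    {g : Fin m} (hg : g ∉ X) (hr : (insert g X).card ≤ r) (htight : 2 * (bdry I X).card ≤ 3 * X.card) :
    ¬ (I.vars g 2 ∈ bdry I X ∧ I.vars g 3 ∈ bdry I X) := by
  rintro ⟨h2, h3⟩
  obtain ⟨j, hj, hv⟩ := exists_mem_of_mem_bdry I h3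
  exact partner_fresh_of_tight I hB hg hr htight (s := 2) (s' := 3) (by decide) (by decide) (by decide) h2 j hj hv

/-! ## The readers of a maximally shared terminal core -/

/-- A private of a chord of `J₀` is a boundary variable of `J₀`. -/
theorem privs_subset_bdry (I : LocalMap 4 n m) {J₀ N : Finset (Fin m)} (hch : ∀ e ∈ N, IsChord I J₀ e) : privs I N ⊆ bdry I J₀ := by
  intro v hv
  obtain ⟨e, he, h | h⟩ := (mem_privs I).1 hv
  · exact h ▸ (hch e he).1
  · exact h ▸ (hch e he).2

/-- **Readers of a maximally shared core.**  `J₀` XOR-closed at maximal sharing (`2·#sharedSlots = #J₀`), `N` a set of chords of `J₀`, `G` a set of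
outputs off `J₀` with `#(J₀ ∪ G) ≤ r` on an `(r,3/2)`-expanding instance.  Then (i) no `g ∈ G` is a CROSS reader of `N`, and (ii) every `g ∈ G`
whose AND slot `s` holds a private of `N` has in its other AND slot `s'` a variable of no output of `J₀` — a FRESH GATE partner. -/
theorem readers_of_maxSharing (I : LocalMap 4 n m) {r : ℕ} (hB : BoundaryExpanding r I) {J₀ N G : Finset (Fin m)} (hX : XorClosed I J₀)
    (hmax : 2 * (sharedSlots I J₀).card = J₀.card) (hch : ∀ e ∈ N, IsChord I J₀ e) (hG : Disjoint G J₀) (hr : (J₀ ∪ G).card ≤ r) :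
    (∀ g ∈ G, ¬ (I.vars g 2 ∈ privs I N ∧ I.vars g 3 ∈ privs I N)) ∧
    ∀ g ∈ G, ∀ s s' : Fin 4, 2 ≤ s.val → 2 ≤ s'.val → s ≠ s' → I.vars g s ∈ privs I N → ∀ j ∈ J₀, I.vars g s' ∉ varSet I j := by
  classical
  have htight := two_mul_card_bdry_le_of_maxSharing I hX hmax
  have hg : ∀ g ∈ G, g ∉ J₀ ∧ (insert g J₀).card ≤ r := fun g hg =>
    ⟨disjoint_left.1 hG hg, (card_le_card (insert_subset (mem_union_right _ hg) subset_union_left)).trans hr⟩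
  refine ⟨fun g hgG h => ?_, fun g hgG s s' hs hs' hne hp => ?_⟩
  · obtain ⟨hgJ, hgr⟩ := hg g hgG
    obtain ⟨j, hj, hv⟩ := exists_mem_of_mem_bdry I (privs_subset_bdry I hch h.2)
    exact partner_fresh_of_tight I hB hgJ hgr htight (s := 2) (s' := 3) (by decide) (by decide) (by decide)
      (privs_subset_bdry I hch h.1) j hj hv
  · obtain ⟨hgJ, hgr⟩ := hg g hgG
    exact partner_fresh_of_tight I hB hgJ hgr htight hs hs' hne (privs_subset_bdry I hch hp)

/-- **The union form** used with bridge data (`G = G₁ ∪ G₂`, `#(J₀ ∪ G₁ ∪ G₂) ≤ r`): no CROSS pendant in either constraint, and fresh partners. -/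
theorem readers_of_maxSharing_union (I : LocalMap 4 n m) {r : ℕ} (hB : BoundaryExpanding r I) {J₀ N G₁ G₂ : Finset (Fin m)}
    (hX : XorClosed I J₀) (hmax : 2 * (sharedSlots I J₀).card = J₀.card) (hch : ∀ e ∈ N, IsChord I J₀ e) (hG₁ : Disjoint G₁ J₀)
    (hG₂ : Disjoint G₂ J₀) (hr : (J₀ ∪ G₁ ∪ G₂).card ≤ r) :
    (∀ g ∈ G₁, ¬ (I.vars g 2 ∈ privs I N ∧ I.vars g 3 ∈ privs I N)) ∧ (∀ g ∈ G₂, ¬ (I.vars g 2 ∈ privs I N ∧ I.vars g 3 ∈ privs I N)) ∧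
    ∀ g ∈ G₁ ∪ G₂, ∀ s s' : Fin 4, 2 ≤ s.val → 2 ≤ s'.val → s ≠ s' → I.vars g s ∈ privs I N → ∀ j ∈ J₀, I.vars g s' ∉ varSet I j := by
  have hr' : (J₀ ∪ (G₁ ∪ G₂)).card ≤ r := by rw [← union_assoc]; exact hr
  obtain ⟨h₁, h₂⟩ := readers_of_maxSharing I hB hX hmax hch (disjoint_union_left.2 ⟨hG₁, hG₂⟩) hr'
  exact ⟨fun g hg => h₁ g (mem_union_left _ hg), fun g hg => h₁ g (mem_union_right _ hg), h₂⟩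

end Summit.PneNP.PneNP.Theorems.PstarMaxSharingReaders
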